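import Summits.QuantumFields.YangMills.Theorems.FluctuationComparisonRegPrIntLS2BetaTransversalShiftUniform
import HarnessLib

/-!
# S2β · DET-REP-B — THE TUBE OF RECORD: a BY-TEXT supplier for the `∃`-tube third of LINE g18-1's displayed organ `DetRepB`

Definition-free helper for `Cruxes/FluctuationComparisonRegPrIntL/Lines/semiclassical_s2beta.lean` v11.2a (crux `stmt-QuantumFields-20520`; width seat
`ym-ust-20520-w4` g16; `--supports`, NOT a proof of any stub).  `DetRepB` (§4c of the line) asserts, per window quadrilateral, `∃ dZ dV e σ UZ UV jZ jV ρ …, TubeRows F hJK dZ dV e σ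
UZ UV jZ jV ρ ∧ …` — nineteen rows of the tubular Haar chart of the residual-gauge × pivot orbit of a fine field: group chart `e` at `1`, continuous transversal `σ` with
`C^∞` matrix field, product window `UZ ×ˢ UV` (`0 ∈ UZ`), **(T2-ALL)** off-pivot quadratic transversality at EVERY point of the transversal window, injectivity,
openness at every point ((F3)), product density `jZ ⊗ jV` with the Haar chart identity, radius `ρ`.  THIS FILE proves that conjunction BY TEXT (token-identical to the
line's `def TubeRows` body, which a Theorems file cannot import) for px21 g11's docked local chart ✓`…TubularChartDockLocal.exists_tubularHaarChart_pivotAct_local` (E3″,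
p747125) at ANY base field `U₀`, with the transversal window SHRUNK to `UV ∩ {y | ∀ b, ‖(eV y)_b‖ < 1∕2}` so that px21's ✓`…TransversalShiftUniform.offPivot_transversal_shift_uniform`
(p750843) supplies (T2-ALL); the Haar chart identity is restricted to the smaller product window (its image is OPEN by (F3), hence measurable; `Measure.restrict_map`,
`restrict_withDensity`, `InjOn.preimage_image_inter`).  Output also records `σ 0 = U₀` and `0 ∈ UV` for the edge rows' base point.

* ★★ `exists_tubeRows` — `∃ e σ UZ UV jZ jV ρ, σ 0 = U₀ ∧ 0 ∈ UV ∧ ⟨TubeRows' nineteen conjuncts, by text⟩`.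

So the organ prover of DET-REP-B `obtain`s the tube and owes only the EDGES (`EdgeRows`), px19's product letters (`ProductRows`) and the Jacobian 4-point.
HONEST: bookkeeping over landed letters; proves NO stub — EXW, GAP♯, DET-REP-B, H4ᶜ, LFR♯ᶜ, S2β and crux 20520 stay OPEN; rung R3 (YM₃ on T³) is NOT d = 4, NOT
infinite volume, NOT a mass gap, NOT Clay; the Yang–Mills mass gap is NOT proved.
-/

noncomputable section

open MeasureTheory MeasureTheory.Measure Filter Topology Set Function Metric
open scoped ENNReal Matrix.Norms.L2Operator
open Literature.MathematicalPhysics.QuantumFieldTheory.Balaban1983to89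
open Literature.MathematicalPhysics.QuantumFieldTheory.Balaban1983to89.T3ContinuumYM3Torus
open Literature.MathematicalPhysics.QuantumFieldTheory.Balaban1983to89.HaarExponentialChart
open Literature.MathematicalPhysics.QuantumFieldTheory.Balaban1983to89.LogChartProduct
open Literature.MathematicalPhysics.QuantumFieldTheory.Balaban1983to89.T3UnitLawDensityEML
open Literature.MathematicalPhysics.QuantumFieldTheory.Balaban1983to89.T3TiltDescent
open scoped Literature.MathematicalPhysics.QuantumFieldTheory.Balaban1983to89.T3OrbitAverage
open Summit.QuantumFields.YangMills.Theorems.FluctuationComparisonRegPrIntLWregChain (iterCentralBond)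
open Summit.QuantumFields.YangMills.Theorems.FluctuationComparisonRegPrIntLS2BetaResidualSubgroup
open Summit.QuantumFields.YangMills.Theorems.FluctuationComparisonRegPrIntLS2BetaTubularChartDockLocal
open Summit.QuantumFields.YangMills.Theorems.FluctuationComparisonRegPrIntLS2BetaTransversalShiftUniform
open Summit.QuantumFields.YangMills.Theorems.FluctuationComparisonRegPrIntLS2BetaSignedCombKill (combSet)

namespace Summit.QuantumFields.YangMills.Theorems.FluctuationComparisonRegPrIntLS2BetaTubeOfRecord

variable (F : T3Family) {J K : ℕ} (hJK : J ≤ K)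

/-- ★★ **THE TUBE OF RECORD CARRIES `TubeRows` (BY TEXT).**  For the dimensions of record and any base field `U₀`: px21 g11's E3″ chart with its transversal window shrunk
to `‖(eV y)_b‖ < 1∕2` satisfies the nineteen displayed tube rows of LINE g18-1's `DetRepB` — (T2-ALL) by ✓`offPivot_transversal_shift_uniform`, the Haar chart identity by
restriction to the (open, by (F3)) image of the smaller window — together with `σ 0 = U₀` and `0 ∈ UV`.
[cite: Helgason2000, Ch. I §1 Thm 1.14 p.96; Balaban1985Variational, Thm 1 (8)-(10) p.279 and (142) p.299; Balaban1985Averaging, (8), (10) p.18] -/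
theorem exists_tubeRows (hk : K - J ≤ (F.P K).m + (F.P K).K)
    [DecidablePred (· ∈ (combSet (K - J) : Set (PBond (F.P K) 0)) ∪ Set.range (iterCentralBond (P := F.P K) (K - J)))] (dZ dV : ℕ)
    (hdZ : dZ = Module.finrank ℝ (specialUnitaryLogChart (Fin 2)).lie *
      ((Fintype.card (Site (F.P K) 0) - Fintype.card (Site (F.P K) (K - J))) + Fintype.card (PBond (F.P K) (K - J))))
    (hdV : dV = Module.finrank ℝ (specialUnitaryLogChart (Fin 2)).lie *
        (Fintype.card (PBond (F.P K) 0) - Fintype.card (PBond (F.P K) (K - J))) -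
      Module.finrank ℝ (specialUnitaryLogChart (Fin 2)).lie * (Fintype.card (Site (F.P K) 0) - Fintype.card (Site (F.P K) (K - J))))
    (U₀ : GaugeField (F.P K) 0 (Matrix.specialUnitaryGroup (Fin 2) ℂ)) :
    ∃ (e : EuclideanSpace ℝ (Fin dZ) → ↥(residualSubgroup F hJK) × (PBond (F.P K) (K - J) → Matrix.specialUnitaryGroup (Fin 2) ℂ))
      (σ : EuclideanSpace ℝ (Fin dV) → GaugeField (F.P K) 0 (Matrix.specialUnitaryGroup (Fin 2) ℂ))
      (UZ : Set (EuclideanSpace ℝ (Fin dZ))) (UV : Set (EuclideanSpace ℝ (Fin dV)))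
      (jZ : EuclideanSpace ℝ (Fin dZ) → ℝ) (jV : EuclideanSpace ℝ (Fin dV) → ℝ) (ρ : ℝ),
      σ 0 = U₀ ∧ (0 : EuclideanSpace ℝ (Fin dV)) ∈ UV ∧
      (Continuous e ∧ e 0 = 1 ∧
      𝓝 (1 : ↥(residualSubgroup F hJK) × (PBond (F.P K) (K - J) → Matrix.specialUnitaryGroup (Fin 2) ℂ)) ≤ map e (𝓝 0) ∧
      Continuous σ ∧
      ContDiff ℝ ⊤ (fun y : EuclideanSpace ℝ (Fin dV) => fun b : PBond (F.P K) 0 => ((σ y b : Matrix.specialUnitaryGroup (Fin 2) ℂ) : Matrix (Fin 2) (Fin 2) ℂ)) ∧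
      IsOpen UZ ∧ IsOpen UV ∧ (0 : EuclideanSpace ℝ (Fin dZ)) ∈ UZ ∧
      (∀ y₁ ∈ UV, ∃ c : ℝ, 0 < c ∧ ∀ᶠ v in 𝓝 (0 : EuclideanSpace ℝ (Fin dV)),
        c * ‖v‖ ^ 2 ≤ ⨅ w : {w : Site (F.P K) 0 → Matrix.specialUnitaryGroup (Fin 2) ℂ |
              ∀ U : GaugeField (F.P K) 0 (Matrix.specialUnitaryGroup (Fin 2) ℂ),
                descendTo F ℰp J K hJK (GaugeField.gaugeAct w U) = descendTo F ℰp J K hJK U},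
            ∑ ℓ ∈ Finset.univ.filter (fun ℓ : PBond (F.P K) 0 =>
                ∀ c', iterCentralBond (P := F.P K) (K - J) c' ≠ ℓ),
              dist1 (σ (y₁ + v) ℓ * ((GaugeField.gaugeAct (w : Site (F.P K) 0 → Matrix.specialUnitaryGroup (Fin 2) ℂ) (σ y₁)) ℓ)⁻¹) ^ 2) ∧
      InjOn (fun p : EuclideanSpace ℝ (Fin dZ) × EuclideanSpace ℝ (Fin dV) =>
        pivotAct F hJK (iterCentralBond (P := F.P K) (K - J)) (e p.1) (σ p.2)) (UZ ×ˢ UV) ∧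
      (∀ p ∈ UZ ×ˢ UV, ∀ s ∈ 𝓝 p, (fun p : EuclideanSpace ℝ (Fin dZ) × EuclideanSpace ℝ (Fin dV) =>
        pivotAct F hJK (iterCentralBond (P := F.P K) (K - J)) (e p.1) (σ p.2)) '' s ∈
        𝓝 ((fun p : EuclideanSpace ℝ (Fin dZ) × EuclideanSpace ℝ (Fin dV) =>
        pivotAct F hJK (iterCentralBond (P := F.P K) (K - J)) (e p.1) (σ p.2)) p)) ∧
      ContinuousOn jZ UZ ∧ ContinuousOn jV UV ∧ (∀ z ∈ UZ, 0 ≤ jZ z) ∧ (∀ y ∈ UV, 0 ≤ jV y) ∧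
      (fieldMeasure (F.P K) 0 (Matrix.specialUnitaryGroup (Fin 2) ℂ)).restrict
          ((fun p : EuclideanSpace ℝ (Fin dZ) × EuclideanSpace ℝ (Fin dV) =>
            pivotAct F hJK (iterCentralBond (P := F.P K) (K - J)) (e p.1) (σ p.2)) '' (UZ ×ˢ UV)) =
        ((((volume : Measure (EuclideanSpace ℝ (Fin dZ))).prod (volume : Measure (EuclideanSpace ℝ (Fin dV)))).restrict (UZ ×ˢ UV)).withDensity
            fun w => ENNReal.ofReal (jZ w.1 * jV w.2)).map
          (fun p : EuclideanSpace ℝ (Fin dZ) × EuclideanSpace ℝ (Fin dV) =>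
            pivotAct F hJK (iterCentralBond (P := F.P K) (K - J)) (e p.1) (σ p.2)) ∧
      0 < ρ ∧ Metric.closedBall (0 : EuclideanSpace ℝ (Fin dZ)) ρ ⊆ UZ ∧ 0 < ∫ z in Metric.ball (0 : EuclideanSpace ℝ (Fin dZ)) ρ, jZ z) := by
  obtain ⟨e, σ, eV, UZ, UV, jZ, jV, ρ, he, he1, he𝓝, hσ, hσ0, hσs, hD0, hD1, hF4a, -, -, hUZo, hUVo, h0Z, h0V, hinj, hF3,
      hjZc, hjVc, hjZ0, hjV0, -, -, -, -, hchart, hρ, hρUZ, hjZint⟩ :=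
    exists_tubularHaarChart_pivotAct_local F hJK hk dZ dV hdZ hdV U₀
  -- the uniform off-pivot transversality of the tube on the small window
  obtain ⟨c₁, hc₁, hT2u⟩ := offPivot_transversal_shift_uniform F hJK hk eV hD0 hD1 hF4a
  -- the shrunk transversal window `UV ∩ S`, `S := ‖(eV y)_b‖ < 1/2` for every free bond
  have hSo : IsOpen {y : EuclideanSpace ℝ (Fin dV) | ∀ b : {b : PBond (F.P K) 0 // b ∉ (combSet (K - J) : Set (PBond (F.P K) 0)) ∪ Set.range (iterCentralBond (P := F.P K) (K - J))}, ‖((eV y : (piLogChart (specialUnitaryLogChart (Fin 2)) {b : PBond (F.P K) 0 // b ∉ (combSet (K - J) : Set (PBond (F.P K) 0)) ∪ Set.range (iterCentralBond (P := F.P K) (K - J))}).lie) : {b : PBond (F.P K) 0 // b ∉ (combSet (K - J) : Set (PBond (F.P K) 0)) ∪ Set.range (iterCentralBond (P := F.P K) (K - J))} → Matrix (Fin 2) (Fin 2) ℂ) b‖ < 1 / 2} := by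
    rw [Set.setOf_forall]
    refine isOpen_iInter_of_finite fun b => ?_
    have hcont : Continuous fun y : EuclideanSpace ℝ (Fin dV) =>
        ‖((eV y : (piLogChart (specialUnitaryLogChart (Fin 2)) {b : PBond (F.P K) 0 // b ∉ (combSet (K - J) : Set (PBond (F.P K) 0)) ∪ Set.range (iterCentralBond (P := F.P K) (K - J))}).lie) : {b : PBond (F.P K) 0 // b ∉ (combSet (K - J) : Set (PBond (F.P K) 0)) ∪ Set.range (iterCentralBond (P := F.P K) (K - J))} → Matrix (Fin 2) (Fin 2) ℂ) b‖ :=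
      ((continuous_apply b).comp (continuous_subtype_val.comp eV.continuous)).norm
    exact isOpen_lt hcont continuous_const
  have h0S : (0 : EuclideanSpace ℝ (Fin dV)) ∈ {y : EuclideanSpace ℝ (Fin dV) | ∀ b : {b : PBond (F.P K) 0 // b ∉ (combSet (K - J) : Set (PBond (F.P K) 0)) ∪ Set.range (iterCentralBond (P := F.P K) (K - J))}, ‖((eV y : (piLogChart (specialUnitaryLogChart (Fin 2)) {b : PBond (F.P K) 0 // b ∉ (combSet (K - J) : Set (PBond (F.P K) 0)) ∪ Set.range (iterCentralBond (P := F.P K) (K - J))}).lie) : {b : PBond (F.P K) 0 // b ∉ (combSet (K - J) : Set (PBond (F.P K) 0)) ∪ Set.range (iterCentralBond (P := F.P K) (K - J))} → Matrix (Fin 2) (Fin 2) ℂ) b‖ < 1 / 2} := by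
    intro b
    simp only [map_zero, ZeroMemClass.coe_zero, Pi.zero_apply, norm_zero]
    norm_num
  have hUV'o : IsOpen (UV ∩ {y : EuclideanSpace ℝ (Fin dV) | ∀ b : {b : PBond (F.P K) 0 // b ∉ (combSet (K - J) : Set (PBond (F.P K) 0)) ∪ Set.range (iterCentralBond (P := F.P K) (K - J))}, ‖((eV y : (piLogChart (specialUnitaryLogChart (Fin 2)) {b : PBond (F.P K) 0 // b ∉ (combSet (K - J) : Set (PBond (F.P K) 0)) ∪ Set.range (iterCentralBond (P := F.P K) (K - J))}).lie) : {b : PBond (F.P K) 0 // b ∉ (combSet (K - J) : Set (PBond (F.P K) 0)) ∪ Set.range (iterCentralBond (P := F.P K) (K - J))} → Matrix (Fin 2) (Fin 2) ℂ) b‖ < 1 / 2}) := hUVo.inter hSo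
  have hsub : UZ ×ˢ (UV ∩ {y : EuclideanSpace ℝ (Fin dV) | ∀ b : {b : PBond (F.P K) 0 // b ∉ (combSet (K - J) : Set (PBond (F.P K) 0)) ∪ Set.range (iterCentralBond (P := F.P K) (K - J))}, ‖((eV y : (piLogChart (specialUnitaryLogChart (Fin 2)) {b : PBond (F.P K) 0 // b ∉ (combSet (K - J) : Set (PBond (F.P K) 0)) ∪ Set.range (iterCentralBond (P := F.P K) (K - J))}).lie) : {b : PBond (F.P K) 0 // b ∉ (combSet (K - J) : Set (PBond (F.P K) 0)) ∪ Set.range (iterCentralBond (P := F.P K) (K - J))} → Matrix (Fin 2) (Fin 2) ℂ) b‖ < 1 / 2}) ⊆ UZ ×ˢ UV := prod_mono le_rfl inter_subset_left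
  -- the tube map is continuous, hence measurable
  have hΘc : Continuous (fun p : EuclideanSpace ℝ (Fin dZ) × EuclideanSpace ℝ (Fin dV) => pivotAct F hJK (iterCentralBond (P := F.P K) (K - J)) (e p.1) (σ p.2)) :=
    (continuous_pivotAct F hJK (iterCentralBond (P := F.P K) (K - J))).comp₂ (he.comp continuous_fst) (hσ.comp continuous_snd)
  have hΘm : Measurable (fun p : EuclideanSpace ℝ (Fin dZ) × EuclideanSpace ℝ (Fin dV) => pivotAct F hJK (iterCentralBond (P := F.P K) (K - J)) (e p.1) (σ p.2)) := hΘc.measurable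
  -- the image of the smaller window is open ((F3)), hence measurable
  have hAopen : IsOpen ((fun p : EuclideanSpace ℝ (Fin dZ) × EuclideanSpace ℝ (Fin dV) => pivotAct F hJK (iterCentralBond (P := F.P K) (K - J)) (e p.1) (σ p.2)) '' (UZ ×ˢ (UV ∩ {y : EuclideanSpace ℝ (Fin dV) | ∀ b : {b : PBond (F.P K) 0 // b ∉ (combSet (K - J) : Set (PBond (F.P K) 0)) ∪ Set.range (iterCentralBond (P := F.P K) (K - J))}, ‖((eV y : (piLogChart (specialUnitaryLogChart (Fin 2)) {b : PBond (F.P K) 0 // b ∉ (combSet (K - J) : Set (PBond (F.P K) 0)) ∪ Set.range (iterCentralBond (P := F.P K) (K - J))}).lie) : {b : PBond (F.P K) 0 // b ∉ (combSet (K - J) : Set (PBond (F.P K) 0)) ∪ Set.range (iterCentralBond (P := F.P K) (K - J))} → Matrix (Fin 2) (Fin 2) ℂ) b‖ < 1 / 2}))) := by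
    refine isOpen_iff_mem_nhds.2 ?_
    rintro _ ⟨p, hp, rfl⟩
    exact hF3 p (hsub hp) _ ((hUZo.prod hUV'o).mem_nhds hp)
  have hA : MeasurableSet ((fun p : EuclideanSpace ℝ (Fin dZ) × EuclideanSpace ℝ (Fin dV) => pivotAct F hJK (iterCentralBond (P := F.P K) (K - J)) (e p.1) (σ p.2)) '' (UZ ×ˢ (UV ∩ {y : EuclideanSpace ℝ (Fin dV) | ∀ b : {b : PBond (F.P K) 0 // b ∉ (combSet (K - J) : Set (PBond (F.P K) 0)) ∪ Set.range (iterCentralBond (P := F.P K) (K - J))}, ‖((eV y : (piLogChart (specialUnitaryLogChart (Fin 2)) {b : PBond (F.P K) 0 // b ∉ (combSet (K - J) : Set (PBond (F.P K) 0)) ∪ Set.range (iterCentralBond (P := F.P K) (K - J))}).lie) : {b : PBond (F.P K) 0 // b ∉ (combSet (K - J) : Set (PBond (F.P K) 0)) ∪ Set.range (iterCentralBond (P := F.P K) (K - J))} → Matrix (Fin 2) (Fin 2) ℂ) b‖ < 1 / 2}))) := hAopen.measurableSet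
  -- the Haar chart identity restricted to the smaller window
  have hchart' : (fieldMeasure (F.P K) 0 (Matrix.specialUnitaryGroup (Fin 2) ℂ)).restrict ((fun p : EuclideanSpace ℝ (Fin dZ) × EuclideanSpace ℝ (Fin dV) => pivotAct F hJK (iterCentralBond (P := F.P K) (K - J)) (e p.1) (σ p.2)) '' (UZ ×ˢ (UV ∩ {y : EuclideanSpace ℝ (Fin dV) | ∀ b : {b : PBond (F.P K) 0 // b ∉ (combSet (K - J) : Set (PBond (F.P K) 0)) ∪ Set.range (iterCentralBond (P := F.P K) (K - J))}, ‖((eV y : (piLogChart (specialUnitaryLogChart (Fin 2)) {b : PBond (F.P K) 0 // b ∉ (combSet (K - J) : Set (PBond (F.P K) 0)) ∪ Set.range (iterCentralBond (P := F.P K) (K - J))}).lie) : {b : PBond (F.P K) 0 // b ∉ (combSet (K - J) : Set (PBond (F.P K) 0)) ∪ Set.range (iterCentralBond (P := F.P K) (K - J))} → Matrix (Fin 2) (Fin 2) ℂ) b‖ < 1 / 2}))) =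
      ((((volume : Measure (EuclideanSpace ℝ (Fin dZ))).prod (volume : Measure (EuclideanSpace ℝ (Fin dV)))).restrict (UZ ×ˢ (UV ∩ {y : EuclideanSpace ℝ (Fin dV) | ∀ b : {b : PBond (F.P K) 0 // b ∉ (combSet (K - J) : Set (PBond (F.P K) 0)) ∪ Set.range (iterCentralBond (P := F.P K) (K - J))}, ‖((eV y : (piLogChart (specialUnitaryLogChart (Fin 2)) {b : PBond (F.P K) 0 // b ∉ (combSet (K - J) : Set (PBond (F.P K) 0)) ∪ Set.range (iterCentralBond (P := F.P K) (K - J))}).lie) : {b : PBond (F.P K) 0 // b ∉ (combSet (K - J) : Set (PBond (F.P K) 0)) ∪ Set.range (iterCentralBond (P := F.P K) (K - J))} → Matrix (Fin 2) (Fin 2) ℂ) b‖ < 1 / 2}))).withDensity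
          fun w => ENNReal.ofReal (jZ w.1 * jV w.2)).map (fun p : EuclideanSpace ℝ (Fin dZ) × EuclideanSpace ℝ (Fin dV) => pivotAct F hJK (iterCentralBond (P := F.P K) (K - J)) (e p.1) (σ p.2)) := by
    have h1 : (fieldMeasure (F.P K) 0 (Matrix.specialUnitaryGroup (Fin 2) ℂ)).restrict ((fun p : EuclideanSpace ℝ (Fin dZ) × EuclideanSpace ℝ (Fin dV) => pivotAct F hJK (iterCentralBond (P := F.P K) (K - J)) (e p.1) (σ p.2)) '' (UZ ×ˢ (UV ∩ {y : EuclideanSpace ℝ (Fin dV) | ∀ b : {b : PBond (F.P K) 0 // b ∉ (combSet (K - J) : Set (PBond (F.P K) 0)) ∪ Set.range (iterCentralBond (P := F.P K) (K - J))}, ‖((eV y : (piLogChart (specialUnitaryLogChart (Fin 2)) {b : PBond (F.P K) 0 // b ∉ (combSet (K - J) : Set (PBond (F.P K) 0)) ∪ Set.range (iterCentralBond (P := F.P K) (K - J))}).lie) : {b : PBond (F.P K) 0 // b ∉ (combSet (K - J) : Set (PBond (F.P K) 0)) ∪ Set.range (iterCentralBond (P := F.P K) (K - J))} → Matrix (Fin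 2) (Fin 2) ℂ) b‖ < 1 / 2}))) =
        ((fieldMeasure (F.P K) 0 (Matrix.specialUnitaryGroup (Fin 2) ℂ)).restrict ((fun p : EuclideanSpace ℝ (Fin dZ) × EuclideanSpace ℝ (Fin dV) => pivotAct F hJK (iterCentralBond (P := F.P K) (K - J)) (e p.1) (σ p.2)) '' (UZ ×ˢ UV))).restrict ((fun p : EuclideanSpace ℝ (Fin dZ) × EuclideanSpace ℝ (Fin dV) => pivotAct F hJK (iterCentralBond (P := F.P K) (K - J)) (e p.1) (σ p.2)) '' (UZ ×ˢ (UV ∩ {y : EuclideanSpace ℝ (Fin dV) | ∀ b : {b : PBond (F.P K) 0 // b ∉ (combSet (K - J) : Set (PBond (F.P K) 0)) ∪ Set.range (iterCentralBond (P := F.P K) (K - J))}, ‖((eV y : (piLogChart (specialUnitaryLogChart (Fin 2)) {b : PBond (F.P K) 0 // b ∉ (combSet (K - J) : Set (PBond (F.P K) 0)) ∪ Set.range (iterCentralBond (P := F.P K) (K - J))}).lie) : {b : PBond (F.P K) 0 // b ∉ (combSet (K - J) : Set (PBond (F.P K) 0)) ∪ Set.range (iterCentralBond (P := F.P K) (K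 - J))} → Matrix (Fin 2) (Fin 2) ℂ) b‖ < 1 / 2}))) := by
      rw [Measure.restrict_restrict hA, inter_eq_left.2 (image_mono hsub)]
    rw [h1, hchart, Measure.restrict_map hΘm hA, restrict_withDensity (hA.preimage hΘm), Measure.restrict_restrict (hA.preimage hΘm),
      hinj.preimage_image_inter hsub]
  refine ⟨e, σ, UZ, UV ∩ {y : EuclideanSpace ℝ (Fin dV) | ∀ b : {b : PBond (F.P K) 0 // b ∉ (combSet (K - J) : Set (PBond (F.P K) 0)) ∪ Set.range (iterCentralBond (P := F.P K) (K - J))}, ‖((eV y : (piLogChart (specialUnitaryLogChart (Fin 2)) {b : PBond (F.P K) 0 // b ∉ (combSet (K - J) : Set (PBond (F.P K) 0)) ∪ Set.range (iterCentralBond (P := F.P K) (K - J))}).lie) : {b : PBond (F.P K) 0 // b ∉ (combSet (K - J) : Set (PBond (F.P K) 0)) ∪ Set.range (iterCentralBond (P := F.P K) (K - J))} → Matrix (Fin 2) (Fin 2) ℂ) b‖ < 1 / 2}, jZ, jV, ρ, hσ0, ⟨h0V, h0S⟩, he, he1, he𝓝, hσ, hσs, hUZo, hUV'o, h0Z, ?_,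 hinj.mono hsub,
    fun p hp s hs => hF3 p (hsub hp) s hs, hjZc.continuousOn, hjVc.continuousOn, fun z _ => hjZ0 z, fun y _ => hjV0 y, hchart', hρ, hρUZ, hjZint⟩
  -- (T2-ALL) on the small window
  intro y₁ hy₁
  exact ⟨c₁, hc₁, hT2u y₁ fun b => (hy₁.2 b).le⟩

end Summit.QuantumFields.YangMills.Theorems.FluctuationComparisonRegPrIntLS2BetaTubeOfRecord

end
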